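import Summits.BirchSwinnertonDyer.BirchSwinnertonDyer.Theorems.Rank2ObservatoryTateDeepCert
import Summits.BirchSwinnertonDyer.BirchSwinnertonDyer.Theorems.Rank2ObservatoryConductorCertStep2
import Summits.BirchSwinnertonDyer.BirchSwinnertonDyer.Theorems.Rank2ObservatoryConductorCert3
import HarnessLib

/-!
# Rank-2 observatory (b2b-bsdr2, cert-2 gen 7): the conductor of an integer equation from a
# root-number certificate and LOCAL TATE CERTIFICATES at `2` and `3` — NO named fact, NO tameness

HONEST FRAMING: per-curve certified theorems and census instruments; no claim on BSD in rank ≥ 2.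

Gen 5/6 proved `conductorNorm ℤ E = N` fact-free for equations tame at `2` and `3`
(`Rank2ObservatoryRank3ConductorFinal`) and for equations of Kodaira type `II/III/IV` at `2` tame at
`3` (`Rank2ObservatoryConductorCertStep2`); the rows additive at `3` needed the named Table-II fact
`h3` (`Rank2ObservatoryConductorCert3`), and the rows of deep type (`I₀*`, `Iₙ*`, `IV*`, `III*`,
`II*`) at `2` kept `hN` as a hypothesis.  With the deep Tate certificates of
`Rank2ObservatoryTateDeepCert` every local exponent at `2` and at `3` is now certifiable, so this file
assembles the conductor in full generality:

* `LocalCert` — ONE uniform local certificate at a prime `p`: kind `0` good (`p ∤ Δ`, `f = 0`),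
  kind `1` multiplicative (`p ∣ Δ`, `p ∤ c₄`, `f = 1`), kind `2` a Step-2 Tate certificate
  (`Step2Cert`, types `II/III/IV`), kind `3` a deep Tate certificate (`DeepCert`, Steps 6–10);
  `LocalCert.conductorExponent_int_eq : l.check p W₀ → conductorExponent v = l.f p` at the place
  `v` of `ℤ` over `p`, GIVEN global minimality of `W₀ ⊗ ℚ` (needed by kind `3` only; the census rows
  have it by `Rank3Row.isGloballyMinimal_of_mem`);
* `conductorNorm_eq_conductorLocal2` — a gen-5 certificate `c : RNCert` (rows tame at `3`) and a
  `LocalCert` at `2`: `conductorNorm ℤ (W₀ ⊗ ℚ) = 2^{f₂} · ∏ p^{condExp} = c.conductorStep2 f₂`;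
* `conductorExponent_eq_of_check3_ne` — for a gen-6 certificate `c : RNCert3` (rows additive at
  `3`), the conductor exponent at every place NOT over `2` or `3`, with NO tameness hypothesis and
  NO named fact (the branch of `conductorExponent_eq_of_check3` that never used `h3`, with the four
  conductor-exponent facts discharged by the tree's theorems);
* `RNCert3.conductorLocal c f₂ f₃ = 2^{f₂} · 3^{f₃} · ∏ p^{condExp3}` and
  **`conductorNorm_eq_conductorLocal23`** — `c.check W₀ → l₂.check 2 W₀ → l₃.check 3 W₀ →
  IsGloballyMinimal → conductorNorm ℤ (W₀ ⊗ ℚ) = c.conductorLocal (l₂.f 2) (l₃.f 3)`: the named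
  fact `h3` of gen 6 is GONE (Tate's algorithm at `3` is now run in the kernel, per curve).

The census instrument (one-pass walk over `rank3Table.zip rank3RNCerts`) and the data chunks are in
`Rank2ObservatoryRank3CondWalk` and `Rank2ObservatoryRank3CondCerts*`.

References: J. H. Silverman, *Advanced Topics in the Arithmetic of Elliptic Curves*, GTM 151 (1994),
IV.9.4, IV.10.2, IV.10.4, IV.11.1 [Silverman1994]; *The Arithmetic of Elliptic Curves*, 2nd ed.
(2009), VII.1.1, VII.5.1, C.16 [SilvermanAEC2009]; J. E. Cremona, *Algorithms for Modular Elliptic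
Curves*, 2nd ed. (1997), §3.2 and Tables [CremonaAlgorithms1997].
-/

open IsDedekindDomain Rat.HeightOneSpectrum WeierstrassCurve Literature
  Literature.NumberTheory.EllipticCurves

/-! ### One uniform local certificate at a prime -/

namespace Summit.BirchSwinnertonDyer.BirchSwinnertonDyer.Rank2Observatory.Tate

open Step2Cert (pdvd pexact pdvd_iff pexact_iff)

/-- A LOCAL CERTIFICATE of the conductor exponent of an integer equation at a prime `p`:
`kind = 0` good reduction (`p ∤ Δ`), `kind = 1` multiplicative (`p ∣ Δ`, `p ∤ c₄`), `kind = 2` a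
Step-2 Tate certificate `⟨p, r, s, t, n, exit, k⟩` (types `II`, `III`, `IV`), `kind = 3` a deep
Tate certificate `⟨p, r, s, t, n, exit, k⟩` (types `I₀*`, `Iₙ*`, `IV*`, `III*`, `II*`; `k` = the
round `m`). [cite: Silverman1994, IV.9.4 and IV.10.2] -/
structure LocalCert where
  /-- `0` good, `1` multiplicative, `2` Step-2 Tate certificate, `3` deep Tate certificate -/
  kind : ℕ
  /-- translation `x = x' + r` (kinds `2`, `3`) -/
  r : ℤ
  /-- `y = y' + s x' + t` -/
  s : ℤ
  /-- `y = y' + s x' + t` -/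
  t : ℤ
  /-- `n = v_p(Δ)` (kinds `2`, `3`) -/
  n : ℕ
  /-- the exit of Tate's algorithm (kinds `2`, `3`) -/
  exit : ℕ
  /-- the exact valuation `k` tested at the exit (kind `2`) / the round `m` (kind `3`) -/
  k : ℕ
  deriving Repr, DecidableEq, Inhabited

namespace LocalCert

variable (l : LocalCert) (p : ℕ) (W : WeierstrassCurve ℤ)

/-- The Step-2 Tate certificate carried by a local certificate of kind `2`. [folklore] -/
def toStep2 : Step2Cert := ⟨p, l.r, l.s, l.t, l.n, l.exit, l.k⟩

/-- The deep Tate certificate carried by a local certificate of kind `3`. [folklore] -/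
def toDeep : DeepCert := ⟨p, l.r, l.s, l.t, l.n, l.exit, l.k⟩

/-- The certified conductor exponent: `0`, `1`, or Ogg's `v(Δ) + 1 − m` of the Tate certificate.
[cite: Silverman1994, IV.10.2 and IV.11.1] -/
def f : ℕ :=
  if l.kind = 0 then 0 else if l.kind = 1 then 1
  else if l.kind = 2 then (l.toStep2 p).f else (l.toDeep p).f

/-- The kernel check of a local certificate on the integer equation `W` at `p`. [folklore] -/
def check : Bool :=
  (l.kind == 0 && !pdvd p 1 W.Δ) || (l.kind == 1 && pdvd p 1 W.Δ && !pdvd p 1 W.c₄) ||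
    (l.kind == 2 && (l.toStep2 p).check W) || (l.kind == 3 && (l.toDeep p).check W)

variable {l p W}

/-- **Soundness of a local certificate**: at the place `v` of `ℤ` over `p`, the conductor exponent
of `W ⊗ ℚ` is the certified one — good reduction (`f = 0`, *AEC* VII.5.1(a)), multiplicative
(`f = 1`, VII.5.1(b)), or a Tate certificate (`Step2Cert.conductorExponent_int_eq`,
`DeepCert.conductorExponent_int_eq`; global minimality feeds the deep one).  The conductor-exponent
facts `f = 0 ↔ good`, `f = 1 ↔ multiplicative` are the tree's theorems.
[cite: Silverman1994, IV.10.2 and IV.11.1] [cite: SilvermanAEC2009, VII.5 Prop. 5.1] -/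
theorem conductorExponent_int_eq [(W.baseChange ℚ).IsElliptic] (v : HeightOneSpectrum ℤ)
    (hv : natGenerator v = p) (hGM : (W.baseChange ℚ).IsGloballyMinimal)
    (hc : l.check p W = true) : (W.baseChange ℚ).conductorExponent v = l.f p := by
  simp only [check, Bool.or_eq_true, Bool.and_eq_true, beq_iff_eq, Bool.not_eq_true', pdvd,
    decide_eq_true_eq, decide_eq_false_iff_not, pow_one] at hc
  rcases hc with ((⟨h0, hΔ⟩ | ⟨⟨h1, hΔ⟩, hc4⟩) | ⟨h2, hc2⟩) | ⟨h3, hc3⟩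
  · rw [f, if_pos h0]
    have e0 : (W.baseChange ℚ).conductorExponent v = 0 ↔ (W.baseChange ℚ).HasGoodReductionAt v :=
      conductorExponent_eq_zero_iff_holds v _
    exact e0.mpr (RootNumber.hasGoodReductionAt_of_not_dvd (by rw [hv]; exact hΔ))
  · rw [f, if_neg (by omega), if_pos h1]
    have e1 : (W.baseChange ℚ).conductorExponent v = 1 ↔
        (W.baseChange ℚ).HasMultiplicativeReductionAt v := conductorExponent_eq_one_iff_holds v _
    exact e1.mpr (RootNumber.hasMultiplicativeReductionAt_of_dvd_of_not_dvd (by rw [hv]; exact hΔ)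
      (by rw [hv]; exact hc4))
  · rw [f, if_neg (by omega), if_neg (by omega), if_pos h2]
    exact Step2Cert.conductorExponent_int_eq v hv hc2
  · rw [f, if_neg (by omega), if_neg (by omega), if_neg (by omega)]
    exact DeepCert.conductorExponent_int_eq v hv hGM hc3

end LocalCert

end Summit.BirchSwinnertonDyer.BirchSwinnertonDyer.Rank2Observatory.Tate

namespace Summit.BirchSwinnertonDyer.BirchSwinnertonDyer.Rank2Observatory.RootNumber

open Tate

/-! ### Rows with a gen-5 certificate (tame at `3`): the exponent at `2` from a local certificate -/

section RNCertRows

variable {W₀ : WeierstrassCurve ℤ} {c : RNCert}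

/-- **The conductor from a root-number certificate and a local certificate at `2`** — NO named fact:
`N (W₀ ⊗ ℚ) = 2^{f₂} · ∏ p^{condExp}` (`= c.conductorStep2 f₂`) with `f₂` the local certificate's
exponent; the odd places are `conductorExponent_eq_of_check_odd` (gen 6).
[cite: Silverman1994, IV.10.2, IV.10.4 and IV.11.1] [cite: SilvermanAEC2009, C.16] -/
theorem conductorNorm_eq_conductorLocal2 (hc : c.check W₀ = true) {l : LocalCert}
    (hl : l.check 2 W₀ = true) (hGM : (W₀.baseChange ℚ).IsGloballyMinimal) :
    (W₀.baseChange ℚ).conductorNorm ℤ = c.conductorStep2 (l.f 2) := by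
  haveI := isElliptic_of_check hc
  obtain ⟨-, -, -, -, hall, -⟩ := RNCert.check_spec hc
  have hprime : ∀ E ∈ c.odd, E.p.Prime := fun E hE ↦ (OddEntry.check_spec (hall E hE)).1
  have hne := prod_condExp_ne_zero hc
  refine Nat.eq_of_factorization_eq
    (conductorNorm_pos_holds (W₀.baseChange ℚ) : 0 < (W₀.baseChange ℚ).conductorNorm ℤ).ne'
    (mul_ne_zero (pow_ne_zero _ two_ne_zero) hne) fun p ↦ ?_
  by_cases hp : p.Prime
  · have hfac : ((W₀.baseChange ℚ).conductorNorm ℤ).factorization (natGenerator (natPlace p)) =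
        (W₀.baseChange ℚ).conductorExponent (natPlace p) := factorization_conductorNorm_holds _ _
    rw [natGenerator_natPlace hp] at hfac
    rw [hfac, RNCert.conductorStep2, Nat.factorization_mul (pow_ne_zero _ two_ne_zero) hne,
      Finsupp.add_apply, factorization_prod_map_pow OddEntry.condExp c.odd hprime p,
      Nat.factorization_pow, Finsupp.smul_apply, smul_eq_mul, Nat.prime_two.factorization,
      Finsupp.single_apply]
    by_cases hp2 : p = 2
    · subst hp2
      rw [if_pos rfl, mul_one, sum_ite_eq_zero _ _ _ fun E hE ↦ (OddEntry.check_spec (hall E hE)).2.1,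
        add_zero]
      exact LocalCert.conductorExponent_int_eq (natPlace 2) (natGenerator_natPlace hp) hGM hl
    · rw [if_neg (Ne.symm hp2), mul_zero, zero_add,
        conductorExponent_eq_of_check_odd hc (natPlace p) (by rwa [natGenerator_natPlace hp]),
        natGenerator_natPlace hp]
  · rw [Nat.factorization_eq_zero_of_not_prime _ hp, Nat.factorization_eq_zero_of_not_prime _ hp]

end RNCertRows

/-! ### Rows with a gen-6 certificate (additive at `3`): exponents at `2` AND `3` from local certificates -/

section RNCert3Rows

variable {W₀ : WeierstrassCurve ℤ} {c : RNCert3}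

/-- **The conductor exponent at a place NOT over `2` or `3`, from a certificate with the place `3`,
NO tameness hypothesis and NO named fact**: `condExp3` at a listed prime `≥ 5` (multiplicative `1`,
additive `2`), `0` elsewhere.  (The `h3`-free branch of `conductorExponent_eq_of_check3`, with the
conductor-exponent facts discharged by the tree's theorems.) [cite: Silverman1994, IV.10.2 and IV.10.4]
[cite: SilvermanAEC2009, VII.5 Prop. 5.1] -/
theorem conductorExponent_eq_of_check3_ne (hc : c.check W₀ = true) (v : HeightOneSpectrum ℤ)
    (hv2 : natGenerator v ≠ 2) (hv3 : natGenerator v ≠ 3) :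
    (W₀.baseChange ℚ).conductorExponent v =
      (c.odd.map fun E => if E.p = natGenerator v then E.condExp3 else 0).sum := by
  obtain ⟨hk2, -, -, -, -, -, hnd, hall, hfac⟩ := RNCert3.check_spec hc
  haveI : (W₀.baseChange ℚ).IsElliptic :=
    WeierstrassCurve.isElliptic_baseChange_int _ (ne_zero_of_exactPow hk2)
  have hdvdΔ : ∀ {E : OddEntry}, E ∈ c.odd → (E.p : ℤ) ∣ W₀.Δ := fun {E} hE ↦ by
    have he : 1 ≤ E.e := (OddEntry.check3_spec (hall E hE)).2.2.2.1
    rw [Int.natCast_dvd, hfac]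
    exact dvd_mul_of_dvd_right (dvd_trans (dvd_pow_self _ (by omega))
      (List.dvd_prod (List.mem_map.mpr ⟨E, hE, rfl⟩))) _
  have e0 : (W₀.baseChange ℚ).conductorExponent v = 0 ↔ (W₀.baseChange ℚ).HasGoodReductionAt v :=
    conductorExponent_eq_zero_iff_holds v _
  have e1 : (W₀.baseChange ℚ).conductorExponent v = 1 ↔
      (W₀.baseChange ℚ).HasMultiplicativeReductionAt v := conductorExponent_eq_one_iff_holds v _
  have e2 : 2 ≤ (W₀.baseChange ℚ).conductorExponent v ↔
      (W₀.baseChange ℚ).HasAdditiveReductionAt v := two_le_conductorExponent_iff_holds v _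
  have e5 : 5 ≤ natGenerator v → (W₀.baseChange ℚ).conductorExponent v ≤ 2 :=
    conductorExponent_le_two_of_five_le_natGenerator_holds _ v
  have hp : (natGenerator v).Prime := prime_natGenerator v
  by_cases hmem : natGenerator v ∈ c.odd.map OddEntry.p
  · -- a listed prime `≥ 5`
    obtain ⟨E, hE, hEp⟩ := List.mem_map.mp hmem
    rw [← hEp, sum_ite_eq_of_nodup _ _ hnd E hE]
    obtain ⟨-, -, -, he, hk3, hne3⟩ := OddEntry.check3_spec (hall E hE)
    have hΔ : (natGenerator v : ℤ) ∣ W₀.Δ := hEp ▸ hdvdΔ hE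
    by_cases hK3 : E.kind = 3
    · rw [OddEntry.condExp3, if_pos hK3]
      obtain ⟨h5p, heΔ, hc40, hlt⟩ := hk3 hK3
      refine le_antisymm (e5 (hEp ▸ h5p)) (e2.mpr ?_)
      exact hasAdditiveReductionAt_of_dvd v he (hEp ▸ (exactPow_spec heΔ).1)
        (hEp ▸ (exactPow_spec heΔ).2) (Or.inl hlt) (by rw [hc40]; exact dvd_zero _)
    rw [OddEntry.condExp3, if_neg hK3]
    obtain ⟨-, -, -, hk0, hk1, hk2'⟩ := OddEntry.check_spec (hne3 hK3)
    by_cases hK0 : E.kind = 0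
    · rw [OddEntry.condExp, if_pos hK0]
      exact e1.mpr (hasMultiplicativeReductionAt_of_dvd_of_not_dvd hΔ (hEp ▸ (hk0 hK0).1))
    by_cases hK1 : E.kind = 1
    · rw [OddEntry.condExp, if_neg hK0, if_pos hK1]
      exact e1.mpr (hasMultiplicativeReductionAt_of_dvd_of_not_dvd hΔ (hEp ▸ (hk1 hK1).1))
    · rw [OddEntry.condExp, if_neg hK0, if_neg hK1]
      obtain ⟨h5p, heΔ, hc₄, htc, hmin⟩ := hk2' hK0 hK1
      refine le_antisymm (e5 (hEp ▸ h5p)) (e2.mpr ?_)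
      refine hasAdditiveReductionAt_of_dvd v he (hEp ▸ (exactPow_spec heΔ).1)
        (hEp ▸ (exactPow_spec heΔ).2) ?_ (hEp ▸ hc₄)
      rcases hmin with h | h
      · exact Or.inl h
      · right
        rw [← hEp]
        exact fun h4 ↦ (exactPow_spec htc).2 (dvd_trans (pow_dvd_pow _ (by omega)) h4)
  · -- off the bad primes: good reduction
    rw [sum_ite_eq_zero _ _ _ fun E hE h ↦ hmem (List.mem_map.mpr ⟨E, hE, h⟩)]
    refine e0.mpr (hasGoodReductionAt_of_not_dvd fun hdvd ↦ ?_)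
    rcases List.mem_cons.mp (mem_of_prime_dvd3 hc hp hdvd) with h | h
    · exact hv2 h
    rcases List.mem_cons.mp h with h | h
    · exact hv3 h
    · exact hmem h

/-- The certified conductor with the exponents at `2` AND `3` SUPPLIED (by local certificates):
`2^{f₂} · 3^{f₃} · ∏ p ^ condExp3`. [cite: Silverman1994, IV.10.2] -/
def RNCert3.conductorLocal (c : RNCert3) (f₂ f₃ : ℕ) : ℕ :=
  2 ^ f₂ * 3 ^ f₃ * (c.odd.map fun E => E.p ^ E.condExp3).prod

/-- **The conductor from a certificate with the place `3` and local certificates at `2` and `3`** —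
NO named fact, NO tameness: `N (W₀ ⊗ ℚ) = 2^{f₂} · 3^{f₃} · ∏ p^{condExp3}`.  Replaces the gen-6
`conductorNorm_eq_conductor3` (tame at `2`, modulo `h3`) for every use.
[cite: Silverman1994, IV.10.2, IV.10.4 and IV.11.1] [cite: SilvermanAEC2009, C.16] -/
theorem conductorNorm_eq_conductorLocal23 (hc : c.check W₀ = true) {l₂ l₃ : LocalCert}
    (h₂ : l₂.check 2 W₀ = true) (h₃ : l₃.check 3 W₀ = true)
    (hGM : (W₀.baseChange ℚ).IsGloballyMinimal) :
    (W₀.baseChange ℚ).conductorNorm ℤ = c.conductorLocal (l₂.f 2) (l₃.f 3) := by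
  obtain ⟨hk2, -, -, -, -, -, -, hall, -⟩ := RNCert3.check_spec hc
  haveI : (W₀.baseChange ℚ).IsElliptic :=
    WeierstrassCurve.isElliptic_baseChange_int _ (ne_zero_of_exactPow hk2)
  have hprime : ∀ E ∈ c.odd, E.p.Prime := fun E hE ↦ (OddEntry.check3_spec (hall E hE)).1
  have hne := prod_condExp3_ne_zero hc
  have h23 : (2 : ℕ) ^ l₂.f 2 * 3 ^ l₃.f 3 ≠ 0 :=
    mul_ne_zero (pow_ne_zero _ two_ne_zero) (pow_ne_zero _ three_ne_zero)
  refine Nat.eq_of_factorization_eq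
    (conductorNorm_pos_holds (W₀.baseChange ℚ) : 0 < (W₀.baseChange ℚ).conductorNorm ℤ).ne'
    (mul_ne_zero h23 hne) fun p ↦ ?_
  by_cases hp : p.Prime
  · have hfac : ((W₀.baseChange ℚ).conductorNorm ℤ).factorization (natGenerator (natPlace p)) =
        (W₀.baseChange ℚ).conductorExponent (natPlace p) := factorization_conductorNorm_holds _ _
    rw [natGenerator_natPlace hp] at hfac
    rw [hfac, RNCert3.conductorLocal, Nat.factorization_mul h23 hne,
      Nat.factorization_mul (pow_ne_zero _ two_ne_zero) (pow_ne_zero _ three_ne_zero),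
      Finsupp.add_apply, Finsupp.add_apply,
      factorization_prod_map_pow OddEntry.condExp3 c.odd hprime p, Nat.factorization_pow,
      Nat.factorization_pow, Finsupp.smul_apply, Finsupp.smul_apply, smul_eq_mul, smul_eq_mul,
      Nat.prime_two.factorization, Nat.prime_three.factorization, Finsupp.single_apply,
      Finsupp.single_apply]
    by_cases hp2 : p = 2
    · subst hp2
      rw [if_pos rfl, if_neg (by decide : (3 : ℕ) ≠ 2), mul_one, mul_zero, add_zero,
        sum_ite_eq_zero _ _ _ fun E hE ↦ (OddEntry.check3_spec (hall E hE)).2.1, add_zero]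
      exact LocalCert.conductorExponent_int_eq (natPlace 2) (natGenerator_natPlace hp) hGM h₂
    by_cases hp3 : p = 3
    · subst hp3
      rw [if_neg (by decide : (2 : ℕ) ≠ 3), if_pos rfl, mul_zero, mul_one, zero_add,
        sum_ite_eq_zero _ _ _ fun E hE ↦ (OddEntry.check3_spec (hall E hE)).2.2.1, add_zero]
      exact LocalCert.conductorExponent_int_eq (natPlace 3) (natGenerator_natPlace hp) hGM h₃
    · rw [if_neg (Ne.symm hp2), if_neg (Ne.symm hp3), mul_zero, mul_zero, zero_add, zero_add,
        conductorExponent_eq_of_check3_ne hc (natPlace p) (by rwa [natGenerator_natPlace hp])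
          (by rwa [natGenerator_natPlace hp]), natGenerator_natPlace hp]
  · rw [Nat.factorization_eq_zero_of_not_prime _ hp, Nat.factorization_eq_zero_of_not_prime _ hp]

end RNCert3Rows

/-! ### Self-tests (kernel) -/

/-- `27747c1 = [0,0,1,−327,2286]` (`N = 27747 = 3² · 3083`): the gen-6 certificate with the place `3`
checks, the local certificates `kind 0` at `2` (`2 ∤ Δ`) and the deep Tate certificate
`(r,s,t) = (8,0,13)`, type `I₂*`, `v₃(Δ) = 8`, `f₃ = 2` at `3` check, and the certified conductor is
`2⁰ · 3² · 3083 = 27747` — NO `h3`. [cite: CremonaAlgorithms1997, Tables] -/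
theorem conductorLocal_27747c1 :
    RNCert3.check ⟨0, 0, 1, -327, 2286⟩ ⟨0, 4, 3, 8, 2, 3, [⟨3083, 55, 1, 1, 1569⟩]⟩ = true ∧
      LocalCert.check ⟨0, 0, 0, 0, 0, 0, 0⟩ 2 ⟨0, 0, 1, -327, 2286⟩ = true ∧
      LocalCert.check ⟨3, 8, 0, 13, 8, 72, 0⟩ 3 ⟨0, 0, 1, -327, 2286⟩ = true ∧
      RNCert3.conductorLocal ⟨0, 4, 3, 8, 2, 3, [⟨3083, 55, 1, 1, 1569⟩]⟩
        (LocalCert.f ⟨0, 0, 0, 0, 0, 0, 0⟩ 2) (LocalCert.f ⟨3, 8, 0, 13, 8, 72, 0⟩ 3) = 27747 := by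
  refine ⟨?_, ?_, ?_, ?_⟩ <;> decide +kernel

end Summit.BirchSwinnertonDyer.BirchSwinnertonDyer.Rank2Observatory.RootNumber
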